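import Summits.Ventures.PercRepro.MSTightSingShapeB
import Summits.Ventures.PercRepro.MSTightConjTTheorem

/-!
# `SingCaseIResidue α` is a theorem; the V-chain closes: `SingNonMonotone α` and (SING-t)

Dossier proofs/MINE1-theoremS.md, Addenda 57–59; HANDOFF §mine-1 gen 32 → 33, step (K7). With the
completion dichotomy (H3) (`completion_dichotomy_of_twinFree`): in a residue instance `(F, u)`,
`r ∈ u`, Case I (`u.erase r ∈ F`), `r` neither removable nor addable, `{r}, univ.erase r ∉ F`,
either `completion0 r F` is tight — SHAPE A, `MSTightSingShapeA.lean` gives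
`u.erase r ∖ s ∈ Y` for every `r`-free member `s` — or `completion1 r F` is tight — SHAPE B, which
is shape A of the complement family `F* = compls F` (`completion0_compls`) with
`ū = univ ∖ u` a partnerless `r`-member (Case II), impossible by `MSTightSingShapeB.lean`.
Hence **`singCaseIResidue : SingCaseIResidue α`**, and through the lane's bridges
(`singNonMonotone_of_residue`, `sing_t_of_singNonMonotone`) **`singNonMonotone : SingNonMonotone α`**
and **(SING-t) at every tight-trace element of a residue instance** (`sing_t`): `{r} ∈ F` or
`univ.erase r ∈ F`.
-/

namespace PercRepro.MSTight

open Finset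
open scoped FinsetFamily

variable {α : Type*} [DecidableEq α] [Fintype α] {F : Finset (Finset α)} {r : α}

section Compls

/-- The members of `F*` avoiding `r` are the complements of the members of `F` containing `r`. -/
theorem part0_compls : part0 r (compls F) = compls (F.filter fun t => r ∈ t) := by
  ext A
  rw [mem_part0, mem_compls, mem_compls, mem_filter]
  constructor
  · rintro ⟨h, hrA⟩
    exact ⟨h, mem_sdiff.2 ⟨mem_univ r, hrA⟩⟩
  · rintro ⟨h, hr⟩
    exact ⟨h, (mem_sdiff.1 hr).2⟩

omit [Fintype α] in
/-- The members of `F` containing `r` are the `r`-members with `r` put back. -/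
theorem filter_mem_eq_image_partr : (F.filter fun t => r ∈ t) = (partr r F).image (insert r) := by
  ext A
  rw [mem_filter, mem_image]
  constructor
  · rintro ⟨hA, hrA⟩
    exact ⟨A.erase r, mem_partr.2 ⟨notMem_erase r A, by rwa [insert_erase hrA]⟩, insert_erase hrA⟩
  · rintro ⟨B, hB, rfl⟩
    exact ⟨(mem_partr.1 hB).2, mem_insert_self r B⟩

/-- The trace of `F*` with `r` put back is the complement family of the trace of `F`. -/
theorem image_insert_proj_compls :
    (proj r (compls F)).image (insert r) = compls (proj r F) := by
  rw [proj_compls]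
  ext A
  rw [mem_image, mem_compls]
  constructor
  · rintro ⟨B, hB, rfl⟩
    obtain ⟨p, hp, rfl⟩ := mem_image.1 hB
    have hrp : r ∉ p := r_notMem_of_mem_proj hp
    have : univ \ insert r (univ.erase r \ p) = p := by
      ext a
      simp only [mem_sdiff, mem_univ, true_and, and_true, mem_insert, mem_erase, not_or, not_and,
        not_not, ne_eq]
      constructor
      · rintro ⟨har, h⟩
        exact h har
      · intro hap
        exact ⟨fun har => hrp (har ▸ hap), fun _ => hap⟩
    rw [this]
    exact hp
  · intro h
    have hrA : r ∈ A := by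
      have := r_notMem_of_mem_proj h
      by_contra hrA
      exact this (mem_sdiff.2 ⟨mem_univ r, hrA⟩)
    refine ⟨univ.erase r \ (univ \ A), mem_image.2 ⟨univ \ A, h, rfl⟩, ?_⟩
    ext a
    simp only [mem_insert, mem_sdiff, mem_erase, mem_univ, true_and, and_true, not_not, ne_eq]
    constructor
    · rintro (rfl | ⟨-, h⟩)
      · exact hrA
      · exact h
    · intro haA
      by_cases har : a = r
      · exact Or.inl har
      · exact Or.inr ⟨har, haA⟩

/-- The complement family commutes with unions. -/
theorem compls_union (A B : Finset (Finset α)) : compls (A ∪ B) = compls A ∪ compls B :=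
  image_union _ _

/-- **The `r`-free completion of `F*` is the complement family of the `r`-completion of `F`.** -/
theorem completion0_compls : completion0 r (compls F) = compls (completion1 r F) := by
  unfold completion0 completion1
  rw [part0_compls, filter_mem_eq_image_partr, image_insert_proj_compls, compls_union, union_comm]

/-- `completion0 r F*` is tight iff `completion1 r F` is. -/
theorem tight_completion0_compls_iff :
    Tight (completion0 r (compls F)) ↔ Tight (completion1 r F) := by
  rw [completion0_compls, tight_compls_iff]

end Compls

section Main

variable {u : Finset α}

/-- **`SingCaseIResidue α` holds** (Addenda 57–59): shape A by
`part0_sdiff_mem_diffsY_of_tight_completion0`, shape B by `false_of_caseII` on `F*`. -/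
theorem singCaseIResidue : SingCaseIResidue α := by
  intro F u r hR hP hru hu1 hrem _hadd _hT hr1 hS s hs
  rcases completion_dichotomy_of_twinFree hR.htf hR.hexc hR.hempty hR.huniv hR.hcore hR.hsupp hP
    with hA | hB
  · exact part0_sdiff_mem_diffsY_of_tight_completion0 hR hP hru hu1 hrem hS hA s hs
  · exfalso
    have hRG := hR.compls
    have hPG : Tight (proj r (compls F)) := (tight_proj_compls_iff F r).2 hP
    have hCG : Tight (completion0 r (compls F)) := by
      rw [completion0_compls, tight_compls_iff]
      exact hB
    have hū : univ \ u ∈ partr r (compls F) := by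
      refine mem_partr.2 ⟨fun h => (mem_sdiff.1 h).2 hru, ?_⟩
      rw [mem_compls]
      have : univ \ insert r (univ \ u) = u.erase r := by
        ext a
        simp only [mem_sdiff, mem_univ, true_and, mem_insert, not_or, not_not, mem_erase, ne_eq]
      rw [this]
      exact hu1
    have hū0 : univ \ u ∉ part0 r (compls F) := by
      intro h
      have := (mem_part0.1 h).1
      rw [mem_compls, compl_compl_eq] at this
      exact hR.hu this
    have hr1G : ({r} : Finset α) ∉ compls F := by
      rw [mem_compls, compl_singleton_eq]
      exact hS
    have hSG : univ.erase r ∉ compls F := by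
      rw [mem_compls, compl_erase_eq]
      exact hr1
    exact false_of_caseII hRG hPG hCG hru hū hū0 hr1G hSG

/-- **`SingNonMonotone α` holds**: the V-chain `(T) + SingCaseIResidue ⟹ SingNonMonotone`. -/
theorem singNonMonotone : SingNonMonotone α :=
  singNonMonotone_of_residue singCaseIResidue

/-- **(SING-t) at every tight-trace element of a residue instance**: `{r} ∈ F` or
`univ.erase r ∈ F`. -/
theorem sing_t (hexc : (F \\ F).card = F.card + 1) (hP : Tight (proj r F))
    (htf : ∀ a b, Twin F a b → a = b) (hcore : ∀ a, ∃ t ∈ F, a ∉ t) (hsupp : ∀ a, ∃ t ∈ F, a ∈ t)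
    (hempty : (∅ : Finset α) ∉ F) (huniv : (univ : Finset α) ∉ F) (hvalid : ∀ t ∈ F, univ \ t ∉ F)
    (hu : u ∉ F) (hu' : univ \ u ∉ F)
    (hsig : ∀ t ∈ F, Cells (F \\ F) t u ∨ Cells (F \\ F) t (univ \ u))
    (hnt : ¬ Tight (insert u F)) (hnt' : ¬ Tight (insert (univ \ u) F)) :
    ({r} : Finset α) ∈ F ∨ univ.erase r ∈ F :=
  sing_t_of_singNonMonotone singNonMonotone hexc hP htf hcore hsupp hempty huniv hvalid hu hu' hsig
    hnt hnt'

end Main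

end PercRepro.MSTight
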